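import Summits.HodgeConjecture.HodgeConjecture.Theorems.PadicSemiregularLiftHodgeFermatVarietiesFibreOfBoundaryPow
import HarnessLib

/-!
# The twin boundary, local part: piece differences at a level `q₀ · n` with TWO boundary primes — line `cancel-by-any-claim-lattice`, crux `HodgeFermatVarieties` (stmt-HodgeConjecture-1334)

Lead c4's programme T6 (skeleton generation 16: the SEXTUPLE TWIN CORE `35 ∣ m`). Lead c2's / the lead's boundary
bricks (`…PairedOfLargePrimesBoundary`, `…FibreOfBoundaryPow`) analyse an odd-annihilated configuration `T` at a
level `q₀ · n` where the first factor `q₀ = p₀^{e₀}` is ONE prime power without room; here `q₀` carries TWO primes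
(in the application `q₀ = 5^a 7^b`), with kernels `U₅ = ker((ℤ/q₀)ˣ → (ℤ/d₅)ˣ)`, `U₇ = ker((ℤ/q₀)ˣ → (ℤ/d₇)ˣ)`
(`d₅ = q₀/5`, `d₇ = q₀/7`) such that a character mod `q₀` factoring through neither `d₅` nor `d₇` is primitive.
For a piece `Tp` of `T` (supported in one sign region at the primes of `n`) and a second coordinate `b`, put
`D(a) = Tp(crt⁻¹(a, b)) − Tp(−crt⁻¹(a, b))`. Proved here:

* `sum_pieceDiff_mul_char_eq_zero` — `D` is killed by EVERY PRIMITIVE character mod `q₀` (the lead's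
  `fibre_const_of_piece_pow` argument, which only used primitivity);
* `char_apply_eq_one_of_factorsThrough` — a character factoring through `d` is `1` on `ker(→ (ℤ/d)ˣ)`;
* `twin_delta` — **the outer-sum structure**: `D(vuy) − D(uy) = D(vy) − D(y)` for `u ∈ U₅`, `v ∈ U₇`
  (the function `a ↦ D(va) − D(a)` is orthogonal to every character not factoring through `d₅` — primitive ones
  kill `D`, the others factor through `d₇` and do not see `v` — so the local Fourier lemma
  `parityPart_mul_eq_of_orthogonal` at `d = d₅`, for both parities, makes it `U₅`-invariant);
* `seven_le_sum_abs_of_delta` — **three rows carry mass ≥ 7**: for an integer-valued `D` with that structure,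
  a point `y` with `D(y) ≥ 1`, some `u₁ ∈ U₅` and some `v₁ ∈ U₇ ∖ {1}` with `D(u₁y) ≤ 0`, `D(v₁y) ≤ 0`, and
  `#U₇ ≥ 6`: `Σ_{v ∈ U₇} (|D(vy)| + |D(vu₁y)| + |D(vu₂y)|) ≥ 7` for any `u₂ ∈ U₅`;
* `sum_three_rows_le_sum_abs` / `two_mul_sum_three_rows_le_sum_abs` — those rows (and, for odd `D` with
  `−1 ∉ U₇U₅`, their negatives) are distinct units, so their mass (twice it) is at most `Σ_a |D(a)|`.
The dichotomy built from these is the sibling `…FibreOfBoundaryTwin`. Everything here is proved; no named facts.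
References: [Aoki1983] N. Aoki, Math. Ann. 266 (1983) 23–54, Lemma 4.4, Prop. 6.4 and §9. -/

-- every sibling file of the line declares into `…CancelByAnyClaimLattice.PairedNull` from a differently named module
set_option linter.dupNamespace false

noncomputable section
open Finset
open Literature.AlgebraicGeometry.HodgeTheory Literature.AlgebraicGeometry.HodgeTheory.FermatCharacter

namespace Summit.HodgeConjecture.HodgeConjecture.Theorems.CancelByAnyClaimLattice

namespace PairedNull
section TwinLocal
variable {q₀ n : ℕ} [NeZero q₀] [NeZero n]

/-- `πq[p']` — reduction from level `q₀ · n` to the prime power `p' ^ v_{p'}(n)` of `n`. Local notation. -/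
local notation3 (prettyPrint := false) "πq[" p' "]" =>
  ZMod.castHom ((Nat.ordProj_dvd n p').trans (dvd_mul_left n q₀)) (ZMod (p' ^ n.factorization p'))

/-- `Reg[P, x, z]` — `z` lies in the region of `x` at the primes of `P`: `z ≡ ±x` modulo `p' ^ v_{p'}(n)`
for every `p' ∈ P`. Local notation. -/
local notation3 (prettyPrint := false) "Reg[" P ", " x ", " z "]" =>
  ∀ p' ∈ (P : Finset ℕ), πq[p'] z = πq[p'] x ∨ πq[p'] z = -(πq[p'] x)

/-- `Dif[Tp, hc, b, a]` — the piece difference `Tp(crt⁻¹(a, b)) − Tp(−crt⁻¹(a, b))`. Local notation. -/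
local notation3 (prettyPrint := false) "Dif[" Tp ", " hc ", " b ", " a "]" =>
  (Tp ((ZMod.chineseRemainder hc).symm (a, b)) - Tp (-(ZMod.chineseRemainder hc).symm (a, b)) : ℂ)

/-- **Piece differences are killed by every primitive character of the first factor.** Let `Tp : ℤ/(q₀ n) → ℂ` be
annihilated by every odd primitive character, supported on units inside one sign region `{z ≡ ±x at every prime of n}`
(all primes of `n` `≥ 5`). Then for every second coordinate `b` and every PRIMITIVE character `χ₁` mod `q₀`,
`Σ_a (Tp(crt⁻¹(a,b)) − Tp(−crt⁻¹(a,b))) χ₁(a) = 0` (pair `χ₁` with the primitive characters mod `n` of the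
complementary parity; on the region their values are `χ₂(±A)`; the sign-orbit lemma `orbit_sign`).
[cite: Aoki1983, Prop. 6.4 and §9] -/
theorem sum_pieceDiff_mul_char_eq_zero (hc : q₀.Coprime n) (hn5 : ∀ p' ∈ n.primeFactors, 5 ≤ p')
    (Tp : ZMod (q₀ * n) → ℂ)
    (hTp : ∀ χ : DirichletCharacter ℂ (q₀ * n), χ.Odd → χ.IsPrimitive → ∑ z : ZMod (q₀ * n), Tp z * χ z = 0)
    {x : ZMod (q₀ * n)} (hx : IsUnit x)
    (hsupp : ∀ z, Tp z ≠ 0 → IsUnit z ∧ Reg[n.primeFactors, x, z])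
    (b : ZMod n) (χ₁ : DirichletCharacter ℂ q₀) (hχ₁p : χ₁.IsPrimitive) :
    ∑ a : ZMod q₀, Dif[Tp, hc, b, a] * χ₁ a = 0 := by
  classical
  -- adapted from the lead's `fibre_const_of_piece_pow` (…FibreOfBoundaryPow), which only used primitivity of `χ₁`
  set A : (ZMod n)ˣ := (hx.map (ZMod.castHom (dvd_mul_left n q₀) (ZMod n))).unit with hA
  set σ : ℂ := χ₁ (-1) with hσ
  have hσsq : σ * σ = 1 := by rw [hσ, ← map_mul, neg_one_mul, neg_neg, map_one]
  have hσpm : σ = 1 ∨ σ = -1 := char_neg_one_eq_or χ₁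
  set H : ZMod n → ℂ := fun b' ↦ ∑ a : ZMod q₀, Tp ((ZMod.chineseRemainder hc).symm (a, b')) * χ₁ a with hH
  -- (i) support of `H` on the sign orbit of `A`
  have hHsupp : ∀ b', H b' ≠ 0 → ∃ u : (ZMod n)ˣ, u * u = 1 ∧ b' = (u : ZMod n) * A := by
    intro b' hb'
    obtain ⟨a, -, ha⟩ := Finset.exists_ne_zero_of_sum_ne_zero hb'
    have hz : Tp ((ZMod.chineseRemainder hc).symm (a, b')) ≠ 0 := fun h0 ↦ ha (by rw [h0, zero_mul])
    obtain ⟨hzu, hreg⟩ := hsupp _ hz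
    obtain ⟨u, hu, hub⟩ := exists_sq_eq_one_of_region (dvd_mul_left n q₀) hx hzu hreg
    refine ⟨u, hu, ?_⟩
    rw [(castHom_crt_symm hc a b').2] at hub
    exact hub
  -- (ii) `H` is orthogonal to the primitive characters of parity `-σ`
  have hHnull : ∀ χ₂ : DirichletCharacter ℂ n, χ₂.IsPrimitive → χ₂ (-1) = -σ →
      ∑ b' : ZMod n, H b' * χ₂ b' = 0 := by
    intro χ₂ hχ₂ hpar
    have hprim := prodChar_isPrimitive hc hχ₁p hχ₂
    have hodd : (DirichletCharacter.changeLevel (dvd_mul_right q₀ n) χ₁ *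
        DirichletCharacter.changeLevel (dvd_mul_left n q₀) χ₂).Odd := by
      rw [DirichletCharacter.Odd, prodChar_neg_one, hpar, ← hσ]
      linear_combination (-1 : ℂ) * hσsq
    have key := hTp _ hodd hprim
    rw [sum_mul_prodChar_eq hc] at key
    simp_rw [Finset.mul_sum] at key
    rw [Finset.sum_comm] at key
    rw [← key]
    refine Finset.sum_congr rfl fun b' _ ↦ ?_
    rw [hH, Finset.sum_mul]
    exact Finset.sum_congr rfl fun a _ ↦ by ring
  -- (iii) the sign-orbit lemma
  have hτ : (-σ = 1 ∨ -σ = -1) := by rcases hσpm with h | h <;> rw [h] <;> norm_num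
  have horbit := orbit_sign n hn5 (-σ) hτ H A hHsupp hHnull
  -- (iv) `∑ D χ₁ = H b - σ H(-b) = 0`
  have hneg : ∑ a : ZMod q₀, Tp (-(ZMod.chineseRemainder hc).symm (a, b)) * χ₁ a = σ * H (-b) := by
    rw [hH, Finset.mul_sum, ← Equiv.sum_comp (Equiv.neg (ZMod q₀))]
    refine Finset.sum_congr rfl fun a _ ↦ ?_
    rw [Equiv.neg_apply, ← crt_symm_neg, neg_neg,
      show χ₁ (-a) = χ₁ (-1) * χ₁ a by rw [← map_mul, neg_one_mul], ← hσ]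
    ring
  have hsplit : ∑ a : ZMod q₀, Dif[Tp, hc, b, a] * χ₁ a =
      H b - ∑ a : ZMod q₀, Tp (-(ZMod.chineseRemainder hc).symm (a, b)) * χ₁ a := by
    rw [hH, ← Finset.sum_sub_distrib]
    exact Finset.sum_congr rfl fun a _ ↦ by ring
  rw [hsplit, hneg, horbit b]
  linear_combination (-(H b)) * hσsq
omit [NeZero n] in
/-- A character factoring through `d` is trivial on the kernel of `(ℤ/q)ˣ → (ℤ/d)ˣ`. [folklore] -/
theorem char_apply_eq_one_of_factorsThrough {d : ℕ} (hd : d ∣ q₀) {χ : DirichletCharacter ℂ q₀}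
    (hχ : χ.FactorsThrough d) (w : (ZMod q₀)ˣ) (hw : ZMod.unitsMap hd w = 1) : χ w = 1 := by
  have hk : w ∈ (ZMod.unitsMap hd).ker := (MonoidHom.mem_ker).mpr hw
  have h1 := (DirichletCharacter.factorsThrough_iff_ker_unitsMap hd).mp hχ hk
  rw [MonoidHom.mem_ker] at h1
  rw [← MulChar.coe_toUnitHom, h1, Units.val_one]

/-- **The outer-sum structure of the piece differences (twin Δ-lemma).** In the situation of
`sum_pieceDiff_mul_char_eq_zero`, let `d₅, d₇ ∣ q₀` be such that every character mod `q₀` factoring through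
neither `d₅` nor `d₇` is primitive. Then for `u ∈ ker(→ (ℤ/d₅)ˣ)`, `v ∈ ker(→ (ℤ/d₇)ˣ)` and every unit `y`:
`D(vuy) − D(uy) = D(vy) − D(y)`, `D(a) = Tp(crt⁻¹(a,b)) − Tp(−crt⁻¹(a,b))`. (The function `F(a) = D(va) − D(a)`
satisfies `Σ F χ = (χ(v)⁻¹ − 1) Σ D χ` for every `χ`; if `χ` does not factor through `d₅` then either it is
primitive and `Σ D χ = 0`, or it factors through `d₇` and `χ(v) = 1`; so the local Fourier lemma at `d = d₅`, for
both parities, gives `F(uy) = F(y)`.) [cite: Aoki1983, Lemma 4.4 and Prop. 6.4] -/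
theorem twin_delta (hc : q₀.Coprime n) (hn5 : ∀ p' ∈ n.primeFactors, 5 ≤ p')
    (Tp : ZMod (q₀ * n) → ℂ)
    (hTp : ∀ χ : DirichletCharacter ℂ (q₀ * n), χ.Odd → χ.IsPrimitive → ∑ z : ZMod (q₀ * n), Tp z * χ z = 0)
    {x : ZMod (q₀ * n)} (hx : IsUnit x)
    (hsupp : ∀ z, Tp z ≠ 0 → IsUnit z ∧ Reg[n.primeFactors, x, z])
    (b : ZMod n) {d₅ d₇ : ℕ} (hd₅ : d₅ ∣ q₀) (hd₇ : d₇ ∣ q₀)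
    (hprim : ∀ χ₁ : DirichletCharacter ℂ q₀, ¬ χ₁.FactorsThrough d₅ → ¬ χ₁.FactorsThrough d₇ → χ₁.IsPrimitive)
    (u v y : (ZMod q₀)ˣ) (hu : ZMod.unitsMap hd₅ u = 1) (hv : ZMod.unitsMap hd₇ v = 1) :
    Dif[Tp, hc, b, (v : ZMod q₀) * ((u : ZMod q₀) * y)] - Dif[Tp, hc, b, (u : ZMod q₀) * y] =
      Dif[Tp, hc, b, (v : ZMod q₀) * y] - Dif[Tp, hc, b, (y : ZMod q₀)] := by
  classical
  set D : ZMod q₀ → ℂ := fun a ↦ Dif[Tp, hc, b, a] with hD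
  set F : ZMod q₀ → ℂ := fun a ↦ D ((v : ZMod q₀) * a) - D a with hF
  -- reindexing: `Σ_a D(va) χ(a) = χ(v)⁻¹ Σ_a D(a) χ(a)`
  have hreidx : ∀ χ : DirichletCharacter ℂ q₀,
      ∑ a : ZMod q₀, D ((v : ZMod q₀) * a) * χ a = (χ v)⁻¹ * ∑ a : ZMod q₀, D a * χ a := by
    intro χ
    have hmul1 : χ ((v⁻¹ : (ZMod q₀)ˣ) : ZMod q₀) * χ v = 1 := by
      rw [← map_mul, Units.inv_mul, map_one]
    have hvinv : (χ v)⁻¹ = χ ((v⁻¹ : (ZMod q₀)ˣ) : ZMod q₀) := (eq_inv_of_mul_eq_one_left hmul1).symm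
    rw [hvinv, Finset.mul_sum,
      ← Equiv.sum_comp (Units.mulLeft v) (fun a ↦ χ ((v⁻¹ : (ZMod q₀)ˣ) : ZMod q₀) * (D a * χ a))]
    refine Finset.sum_congr rfl fun a _ ↦ ?_
    rw [Units.mulLeft_apply]
    have : χ ((v⁻¹ : (ZMod q₀)ˣ) : ZMod q₀) * χ ((v : ZMod q₀) * a) = χ a := by
      rw [← map_mul, ← mul_assoc, Units.inv_mul, one_mul]
    rw [mul_left_comm, this]
  have horth : ∀ χ : DirichletCharacter ℂ q₀, ¬ χ.FactorsThrough d₅ → ∑ a : ZMod q₀, F a * χ a = 0 := by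
    intro χ hχ5
    have hsplit : ∑ a : ZMod q₀, F a * χ a = ((χ v)⁻¹ - 1) * ∑ a : ZMod q₀, D a * χ a := by
      rw [sub_mul, one_mul, ← hreidx, ← Finset.sum_sub_distrib]
      exact Finset.sum_congr rfl fun a _ ↦ by rw [hF]; ring
    rw [hsplit]
    by_cases hχ7 : χ.FactorsThrough d₇
    · rw [char_apply_eq_one_of_factorsThrough hd₇ hχ7 v hv, inv_one, sub_self, zero_mul]
    · rw [sum_pieceDiff_mul_char_eq_zero hc hn5 Tp hTp hx hsupp b χ (hprim χ hχ5 hχ7), mul_zero]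
  have h1 := parityPart_mul_eq_of_orthogonal hd₅ F (Or.inl rfl) (fun χ _ hχ ↦ horth χ hχ) u y hu
  have h2 := parityPart_mul_eq_of_orthogonal hd₅ F (Or.inr rfl) (fun χ _ hχ ↦ horth χ hχ) u y hu
  have h3 : (2 : ℂ) * F ((u : ZMod q₀) * y) = 2 * F y := by linear_combination h1 + h2
  have h4 := mul_left_cancel₀ (two_ne_zero (α := ℂ)) h3
  simpa only [hF, hD] using h4
omit [NeZero n] in
/-- **Three rows carry mass at least `7`.** Let `D : ℤ/q₀ → ℤ` satisfy `D(vuy) − D(uy) = D(vy) − D(y)` for `u` in the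
kernel towards `d₅` and `v` in the kernel `U₇` towards `d₇` (`#U₇ ≥ 6`). If `D(y) ≥ 1`, `D(u₁y) ≤ 0` for some `u₁`
in the first kernel and `D(v₁y) ≤ 0` for some `v₁ ≠ 1` in `U₇`, then for every `u₂` in the first kernel
`Σ_{v ∈ U₇} (|D(vy)| + |D(vu₁y)| + |D(vu₂y)|) ≥ 7`: each `v` gives `|D(vy)| + |D(vu₁y)| ≥ D(y) − D(u₁y) ≥ 1`, and
`|D(u₂y)| + |D(v₁u₂y)| ≥ D(y) − D(v₁y) ≥ 1`. [cite: Aoki1983, §9 (counting)] -/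
theorem seven_le_sum_abs_of_delta {D : ZMod q₀ → ℤ} {d₅ d₇ : ℕ} (hd₅ : d₅ ∣ q₀) (hd₇ : d₇ ∣ q₀)
    (hΔ : ∀ u v y : (ZMod q₀)ˣ, ZMod.unitsMap hd₅ u = 1 → ZMod.unitsMap hd₇ v = 1 →
      D ((v : ZMod q₀) * ((u : ZMod q₀) * y)) - D ((u : ZMod q₀) * y) = D ((v : ZMod q₀) * y) - D y)
    (y u₁ u₂ v₁ : (ZMod q₀)ˣ) (hu₁ : ZMod.unitsMap hd₅ u₁ = 1) (hu₂ : ZMod.unitsMap hd₅ u₂ = 1)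
    (hv₁ : ZMod.unitsMap hd₇ v₁ = 1) (hv₁1 : v₁ ≠ 1)
    (hy : 1 ≤ D y) (hDu₁ : D ((u₁ : ZMod q₀) * y) ≤ 0) (hDv₁ : D ((v₁ : ZMod q₀) * y) ≤ 0)
    (hK : 6 ≤ #(univ.filter fun v : (ZMod q₀)ˣ ↦ ZMod.unitsMap hd₇ v = 1)) :
    7 ≤ ∑ v ∈ univ.filter (fun v : (ZMod q₀)ˣ ↦ ZMod.unitsMap hd₇ v = 1),
      (|D ((v : ZMod q₀) * y)| + |D ((v : ZMod q₀) * ((u₁ : ZMod q₀) * y))| +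
        |D ((v : ZMod q₀) * ((u₂ : ZMod q₀) * y))|) := by
  classical
  set K := univ.filter (fun v : (ZMod q₀)ˣ ↦ ZMod.unitsMap hd₇ v = 1) with hKdef
  have hrow : ∀ v ∈ K, (1 : ℤ) ≤ |D ((v : ZMod q₀) * y)| + |D ((v : ZMod q₀) * ((u₁ : ZMod q₀) * y))| := by
    intro v hv
    have hvK : ZMod.unitsMap hd₇ v = 1 := (mem_filter.mp hv).2
    have h := hΔ u₁ v y hu₁ hvK
    have ha := le_abs_self (D ((v : ZMod q₀) * y))
    have hb := neg_le_abs (D ((v : ZMod q₀) * ((u₁ : ZMod q₀) * y)))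
    linarith
  have h1K : (1 : (ZMod q₀)ˣ) ∈ K := by
    rw [hKdef, mem_filter]; exact ⟨mem_univ _, map_one _⟩
  have hv₁K : v₁ ∈ K := by rw [hKdef, mem_filter]; exact ⟨mem_univ _, hv₁⟩
  -- the first two columns: at least `#K ≥ 6`
  have hsum12 : (6 : ℤ) ≤ ∑ v ∈ K, (|D ((v : ZMod q₀) * y)| + |D ((v : ZMod q₀) * ((u₁ : ZMod q₀) * y))|) := by
    have h := Finset.card_nsmul_le_sum K _ 1 hrow
    rw [nsmul_eq_mul, mul_one] at h
    have hK' : (6 : ℤ) ≤ (#K : ℤ) := by exact_mod_cast hK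
    exact hK'.trans h
  -- the third column: at least `1`, from the rows `v = 1` and `v = v₁`
  have hsum3 : (1 : ℤ) ≤ ∑ v ∈ K, |D ((v : ZMod q₀) * ((u₂ : ZMod q₀) * y))| := by
    have hsub : ({1, v₁} : Finset (ZMod q₀)ˣ) ⊆ K := by
      intro w hw
      rcases mem_insert.mp hw with rfl | hw
      · exact h1K
      · rw [mem_singleton.mp hw]; exact hv₁K
    have hle := Finset.sum_le_sum_of_subset_of_nonneg hsub
      (fun w _ _ ↦ abs_nonneg (D ((w : ZMod q₀) * ((u₂ : ZMod q₀) * y))))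
    rw [Finset.sum_pair (Ne.symm hv₁1)] at hle
    have h := hΔ u₂ v₁ y hu₂ hv₁
    have ha := le_abs_self (D (((1 : (ZMod q₀)ˣ) : ZMod q₀) * ((u₂ : ZMod q₀) * y)))
    have hb := neg_le_abs (D ((v₁ : ZMod q₀) * ((u₂ : ZMod q₀) * y)))
    rw [Units.val_one, one_mul] at ha
    have hone : D (((1 : (ZMod q₀)ˣ) : ZMod q₀) * ((u₂ : ZMod q₀) * y)) = D ((u₂ : ZMod q₀) * y) := by
      rw [Units.val_one, one_mul]
    rw [hone] at hle
    linarith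
  rw [Finset.sum_add_distrib]
  linarith
omit [NeZero n] in
/-- **The three rows are distinct units**: if `1, u₁, u₂` are distinct elements of the kernel towards `d₅` and the two
kernels meet trivially, the `3 · #U₇` points `vy, vu₁y, vu₂y` (`v ∈ U₇`) are distinct: their mass is `≤ Σ_a |D(a)|`. [folklore] -/
theorem sum_three_rows_le_sum_abs (D : ZMod q₀ → ℤ) {d₅ d₇ : ℕ} (hd₅ : d₅ ∣ q₀) (hd₇ : d₇ ∣ q₀)
    (hker : ∀ w : (ZMod q₀)ˣ, ZMod.unitsMap hd₅ w = 1 → ZMod.unitsMap hd₇ w = 1 → w = 1)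
    (y u₁ u₂ : (ZMod q₀)ˣ) (hu₁ : ZMod.unitsMap hd₅ u₁ = 1) (hu₂ : ZMod.unitsMap hd₅ u₂ = 1)
    (h01 : u₁ ≠ 1) (h02 : u₂ ≠ 1) (h12 : u₁ ≠ u₂) :
    ∑ v ∈ univ.filter (fun v : (ZMod q₀)ˣ ↦ ZMod.unitsMap hd₇ v = 1),
      (|D ((v : ZMod q₀) * y)| + |D ((v : ZMod q₀) * ((u₁ : ZMod q₀) * y))| +
        |D ((v : ZMod q₀) * ((u₂ : ZMod q₀) * y))|) ≤ ∑ a : (ZMod q₀)ˣ, |D (a : ZMod q₀)| := by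
  classical
  set K := univ.filter (fun v : (ZMod q₀)ˣ ↦ ZMod.unitsMap hd₇ v = 1) with hKdef
  -- the three rows as images of `K`
  set f₀ : (ZMod q₀)ˣ → (ZMod q₀)ˣ := fun v ↦ v * y with hf₀
  set f₁ : (ZMod q₀)ˣ → (ZMod q₀)ˣ := fun v ↦ v * (u₁ * y) with hf₁
  set f₂ : (ZMod q₀)ˣ → (ZMod q₀)ˣ := fun v ↦ v * (u₂ * y) with hf₂
  have hinj : ∀ c : (ZMod q₀)ˣ, Set.InjOn (fun v : (ZMod q₀)ˣ ↦ v * c) K :=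
    fun c v _ v' _ h ↦ mul_right_cancel h
  -- two rows through `u, u'` in the first kernel are disjoint unless `u = u'`
  have hdisj : ∀ u u' : (ZMod q₀)ˣ, ZMod.unitsMap hd₅ u = 1 → ZMod.unitsMap hd₅ u' = 1 → u ≠ u' →
      Disjoint (K.image fun v ↦ v * (u * y)) (K.image fun v ↦ v * (u' * y)) := by
    intro u u' hu hu' hne
    rw [Finset.disjoint_left]
    intro w hw hw'
    obtain ⟨v, hv, rfl⟩ := mem_image.mp hw
    obtain ⟨v', hv', hEq⟩ := mem_image.mp hw'
    have hvK : ZMod.unitsMap hd₇ v = 1 := (mem_filter.mp hv).2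
    have hv'K : ZMod.unitsMap hd₇ v' = 1 := (mem_filter.mp hv').2
    -- `v' u' = v u`, so `w := v⁻¹ v' = u u'⁻¹` lies in both kernels
    have h1 : v⁻¹ * v' = u * u'⁻¹ := by
      have h := hEq
      rw [← mul_assoc, ← mul_assoc] at h
      have h' : v' * u' = v * u := mul_right_cancel h
      calc v⁻¹ * v' = v⁻¹ * (v' * u') * u'⁻¹ := by group
        _ = v⁻¹ * (v * u) * u'⁻¹ := by rw [h']
        _ = u * u'⁻¹ := by group
    have hw5 : ZMod.unitsMap hd₅ (v⁻¹ * v') = 1 := by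
      rw [h1, map_mul, map_inv, hu, hu', inv_one, mul_one]
    have hw7 : ZMod.unitsMap hd₇ (v⁻¹ * v') = 1 := by
      rw [map_mul, map_inv, hvK, hv'K, inv_one, mul_one]
    have hw1 := hker _ hw5 hw7
    rw [h1, mul_inv_eq_one] at hw1
    exact hne hw1
  -- rewrite each row as a sum over an image
  have hrow : ∀ c : (ZMod q₀)ˣ, ∑ v ∈ K, |D ((v : ZMod q₀) * (c : ZMod q₀))| =
      ∑ a ∈ K.image (fun v ↦ v * c), |D (a : ZMod q₀)| := by
    intro c
    rw [Finset.sum_image (hinj c)]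
    rfl
  have hy1 : (y : ZMod q₀) = ((1 * y : (ZMod q₀)ˣ) : ZMod q₀) := by rw [one_mul]
  rw [Finset.sum_add_distrib, Finset.sum_add_distrib]
  have e₀ : ∑ v ∈ K, |D ((v : ZMod q₀) * y)| = ∑ a ∈ K.image (fun v ↦ v * (1 * y)), |D (a : ZMod q₀)| := by
    rw [← hrow (1 * y), one_mul]
  have e₁ : ∑ v ∈ K, |D ((v : ZMod q₀) * ((u₁ : ZMod q₀) * y))| =
      ∑ a ∈ K.image (fun v ↦ v * (u₁ * y)), |D (a : ZMod q₀)| := by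
    rw [← hrow (u₁ * y), Units.val_mul]
  have e₂ : ∑ v ∈ K, |D ((v : ZMod q₀) * ((u₂ : ZMod q₀) * y))| =
      ∑ a ∈ K.image (fun v ↦ v * (u₂ * y)), |D (a : ZMod q₀)| := by
    rw [← hrow (u₂ * y), Units.val_mul]
  rw [e₀, e₁, e₂]
  have hone : ZMod.unitsMap hd₅ (1 : (ZMod q₀)ˣ) = 1 := map_one _
  have d01 := hdisj 1 u₁ hone hu₁ (Ne.symm h01)
  have d02 := hdisj 1 u₂ hone hu₂ (Ne.symm h02)
  have d12 := hdisj u₁ u₂ hu₁ hu₂ h12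
  rw [← Finset.sum_union d01, ← Finset.sum_union (Finset.disjoint_union_left.mpr ⟨d02, d12⟩)]
  exact Finset.sum_le_sum_of_subset_of_nonneg (Finset.subset_univ _) (fun a _ _ ↦ abs_nonneg _)
omit [NeZero n] in
/-- **… and with their negatives, for an odd `D`**: if moreover `D(−a) = −D(a)` on units and `−1 ∉ U₇ · U₅`, the three
rows and their negatives are `6 · #U₇` distinct units, so `2 · (mass of the three rows) ≤ Σ_a |D(a)|`. [folklore] -/
theorem two_mul_sum_three_rows_le_sum_abs (D : ZMod q₀ → ℤ) {d₅ d₇ : ℕ} (hd₅ : d₅ ∣ q₀) (hd₇ : d₇ ∣ q₀)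
    (hker : ∀ w : (ZMod q₀)ˣ, ZMod.unitsMap hd₅ w = 1 → ZMod.unitsMap hd₇ w = 1 → w = 1)
    (hm1 : ∀ u v : (ZMod q₀)ˣ, ZMod.unitsMap hd₅ u = 1 → ZMod.unitsMap hd₇ v = 1 → v * u ≠ -1)
    (hodd : ∀ a : (ZMod q₀)ˣ, D (-(a : ZMod q₀)) = -D (a : ZMod q₀))
    (y u₁ u₂ : (ZMod q₀)ˣ) (hu₁ : ZMod.unitsMap hd₅ u₁ = 1) (hu₂ : ZMod.unitsMap hd₅ u₂ = 1)
    (h01 : u₁ ≠ 1) (h02 : u₂ ≠ 1) (h12 : u₁ ≠ u₂) :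
    2 * ∑ v ∈ univ.filter (fun v : (ZMod q₀)ˣ ↦ ZMod.unitsMap hd₇ v = 1),
      (|D ((v : ZMod q₀) * y)| + |D ((v : ZMod q₀) * ((u₁ : ZMod q₀) * y))| +
        |D ((v : ZMod q₀) * ((u₂ : ZMod q₀) * y))|) ≤ ∑ a : (ZMod q₀)ˣ, |D (a : ZMod q₀)| := by
  classical
  set K := univ.filter (fun v : (ZMod q₀)ˣ ↦ ZMod.unitsMap hd₇ v = 1) with hKdef
  -- the set of the three rows
  set P : Finset (ZMod q₀)ˣ := (K.image fun v ↦ v * (1 * y)) ∪ ((K.image fun v ↦ v * (u₁ * y)) ∪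
    (K.image fun v ↦ v * (u₂ * y))) with hPdef
  -- membership in `P`: `w = v u y` with `v ∈ U₇`, `u ∈ {1, u₁, u₂}`
  have hmemP : ∀ w ∈ P, ∃ v u : (ZMod q₀)ˣ, ZMod.unitsMap hd₇ v = 1 ∧ ZMod.unitsMap hd₅ u = 1 ∧ w = v * (u * y) := by
    intro w hw
    rcases mem_union.mp hw with h | h
    · obtain ⟨v, hv, rfl⟩ := mem_image.mp h
      exact ⟨v, 1, (mem_filter.mp hv).2, map_one _, rfl⟩
    rcases mem_union.mp h with h | h
    · obtain ⟨v, hv, rfl⟩ := mem_image.mp h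
      exact ⟨v, u₁, (mem_filter.mp hv).2, hu₁, rfl⟩
    · obtain ⟨v, hv, rfl⟩ := mem_image.mp h
      exact ⟨v, u₂, (mem_filter.mp hv).2, hu₂, rfl⟩
  -- `P` and `-P` are disjoint
  have hdisj : Disjoint P (P.image fun w ↦ -w) := by
    rw [Finset.disjoint_left]
    intro w hw hw'
    obtain ⟨w', hw'P, hEq⟩ := mem_image.mp hw'
    obtain ⟨v, u, hv, hu, rfl⟩ := hmemP w hw
    obtain ⟨v', u', hv', hu', rfl⟩ := hmemP w' hw'P
    -- `-(v' u' y) = v u y` ⟹ `(v⁻¹ v')(u' u⁻¹) = -1`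
    have h1 : (v⁻¹ * v') * (u' * u⁻¹) = -1 := by
      have h : -(v' * (u' * y)) = v * (u * y) := hEq
      calc (v⁻¹ * v') * (u' * u⁻¹) = v⁻¹ * (v' * (u' * y)) * (u * y)⁻¹ := by group
        _ = v⁻¹ * (-(v * (u * y))) * (u * y)⁻¹ := by rw [← h, neg_neg]
        _ = -1 := by rw [mul_neg, neg_mul]; group
    have hv'' : ZMod.unitsMap hd₇ (v⁻¹ * v') = 1 := by rw [map_mul, map_inv, hv, hv', inv_one, one_mul]
    have hu'' : ZMod.unitsMap hd₅ (u' * u⁻¹) = 1 := by rw [map_mul, map_inv, hu, hu', inv_one, mul_one]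
    exact hm1 _ _ hu'' hv'' h1
  -- the mass of `-P` equals the mass of `P`
  have hnegsum : ∑ a ∈ P.image (fun w ↦ -w), |D (a : ZMod q₀)| = ∑ a ∈ P, |D (a : ZMod q₀)| := by
    rw [Finset.sum_image (fun w _ w' _ h ↦ neg_injective h)]
    exact Finset.sum_congr rfl fun w _ ↦ by rw [Units.val_neg, hodd, abs_neg]
  have hP := sum_three_rows_le_sum_abs D hd₅ hd₇ hker y u₁ u₂ hu₁ hu₂ h01 h02 h12
  -- the mass of the three rows is the mass of `P` (same computation as in `sum_three_rows_le_sum_abs`)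
  have hinj : ∀ c : (ZMod q₀)ˣ, Set.InjOn (fun v : (ZMod q₀)ˣ ↦ v * c) K :=
    fun c v _ v' _ h ↦ mul_right_cancel h
  have hrow : ∀ c : (ZMod q₀)ˣ, ∑ v ∈ K, |D ((v : ZMod q₀) * (c : ZMod q₀))| =
      ∑ a ∈ K.image (fun v ↦ v * c), |D (a : ZMod q₀)| := by
    intro c
    rw [Finset.sum_image (hinj c)]
    rfl
  have hdisjP : ∀ u u' : (ZMod q₀)ˣ, ZMod.unitsMap hd₅ u = 1 → ZMod.unitsMap hd₅ u' = 1 → u ≠ u' →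
      Disjoint (K.image fun v ↦ v * (u * y)) (K.image fun v ↦ v * (u' * y)) := by
    intro u u' hu hu' hne
    rw [Finset.disjoint_left]
    intro w hw hw'
    obtain ⟨v, hv, rfl⟩ := mem_image.mp hw
    obtain ⟨v', hv', hEq⟩ := mem_image.mp hw'
    have hvK : ZMod.unitsMap hd₇ v = 1 := (mem_filter.mp hv).2
    have hv'K : ZMod.unitsMap hd₇ v' = 1 := (mem_filter.mp hv').2
    have h1 : v⁻¹ * v' = u * u'⁻¹ := by
      have h := hEq
      rw [← mul_assoc, ← mul_assoc] at h
      have h' : v' * u' = v * u := mul_right_cancel h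
      calc v⁻¹ * v' = v⁻¹ * (v' * u') * u'⁻¹ := by group
        _ = v⁻¹ * (v * u) * u'⁻¹ := by rw [h']
        _ = u * u'⁻¹ := by group
    have hw5 : ZMod.unitsMap hd₅ (v⁻¹ * v') = 1 := by
      rw [h1, map_mul, map_inv, hu, hu', inv_one, mul_one]
    have hw7 : ZMod.unitsMap hd₇ (v⁻¹ * v') = 1 := by
      rw [map_mul, map_inv, hvK, hv'K, inv_one, mul_one]
    have hw1 := hker _ hw5 hw7
    rw [h1, mul_inv_eq_one] at hw1
    exact hne hw1
  have hone : ZMod.unitsMap hd₅ (1 : (ZMod q₀)ˣ) = 1 := map_one _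
  have hsumP : ∑ v ∈ K, (|D ((v : ZMod q₀) * y)| + |D ((v : ZMod q₀) * ((u₁ : ZMod q₀) * y))| +
      |D ((v : ZMod q₀) * ((u₂ : ZMod q₀) * y))|) = ∑ a ∈ P, |D (a : ZMod q₀)| := by
    rw [Finset.sum_add_distrib, Finset.sum_add_distrib]
    have e₀ : ∑ v ∈ K, |D ((v : ZMod q₀) * y)| = ∑ a ∈ K.image (fun v ↦ v * (1 * y)), |D (a : ZMod q₀)| := by
      rw [← hrow (1 * y), one_mul]
    rw [e₀, ← Units.val_mul, ← Units.val_mul, hrow (u₁ * y), hrow (u₂ * y), hPdef,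
      Finset.sum_union (Finset.disjoint_union_right.mpr ⟨hdisjP 1 u₁ hone hu₁ (Ne.symm h01),
        hdisjP 1 u₂ hone hu₂ (Ne.symm h02)⟩),
      Finset.sum_union (hdisjP u₁ u₂ hu₁ hu₂ h12), add_assoc]
  rw [hsumP, two_mul]
  nth_rewrite 2 [← hnegsum]
  rw [← Finset.sum_union hdisj]
  exact Finset.sum_le_sum_of_subset_of_nonneg (Finset.subset_univ _) (fun a _ _ ↦ abs_nonneg _)

end TwinLocal

/-- **Registered form of `seven_le_sum_abs_of_delta`** (three rows carry mass `≥ 7`). [cite: Aoki1983, §9 (counting)] -/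
theorem stub_seven_le_sum_abs_of_delta : ∀ {q₀ : ℕ} [NeZero q₀] {D : ZMod q₀ → ℤ} {d₅ d₇ : ℕ} (hd₅ : d₅ ∣ q₀) (hd₇ : d₇ ∣ q₀), (∀ u v y : (ZMod q₀)ˣ, ZMod.unitsMap hd₅ u = 1 → ZMod.unitsMap hd₇ v = 1 → D ((v : ZMod q₀) * ((u : ZMod q₀) * y)) - D ((u : ZMod q₀) * y) = D ((v : ZMod q₀) * y) - D y) → ∀ (y u₁ u₂ v₁ : (ZMod q₀)ˣ), ZMod.unitsMap hd₅ u₁ = 1 → ZMod.unitsMap hd₅ u₂ = 1 → ZMod.unitsMap hd₇ v₁ = 1 → v₁ ≠ 1 → 1 ≤ D y → D ((u₁ : ZMod q₀) * y) ≤ 0 → D ((v₁ : ZMod q₀) * y) ≤ 0 → 6 ≤ #(univ.filter fun v : (ZMod q₀)ˣ ↦ ZMod.unitsMap hd₇ v = 1) → 7 ≤ ∑ v ∈ univ.filter (fun v : (ZMod q₀)ˣ ↦ ZMod.unitsMap hd₇ v = 1), (|D ((v : ZMod q₀) * y)| + |D ((v : ZMod q₀) * ((u₁ : ZMod q₀)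 * y))| + |D ((v : ZMod q₀) * ((u₂ : ZMod q₀) * y))|) :=
  fun hd₅ hd₇ hΔ y u₁ u₂ v₁ hu₁ hu₂ hv₁ hv₁1 hy hDu₁ hDv₁ hK ↦
    seven_le_sum_abs_of_delta hd₅ hd₇ hΔ y u₁ u₂ v₁ hu₁ hu₂ hv₁ hv₁1 hy hDu₁ hDv₁ hK

end PairedNull
end Summit.HodgeConjecture.HodgeConjecture.Theorems.CancelByAnyClaimLattice
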